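import Summits.QuantumFields.YangMills.Theorems.BalabanUVNodesN27AtRecord11

/-!
# BalabanUVNodes ∕ N27 = binder B5 AT THE RECORD, XXII — N27 KEYED AT NODE 00's STAGE-11 OBJECTS: binder B5 at the Stage-11 record predicate READ OFF the parameter tuples
# `(θ : Node00.Stage11Params F N, hP : θ.Provisos₁₁, θ.Admissible)` — the record-predicate parameters `SRec` ∕ `RRec` ∕ `Inputs` of XII–XXI ELIMINATED in favour of two
# READINGS of carriers off the tuples, n20-e's spine-carrier reading `cr` (`…N20AtRecord11`, p450743) VERBATIM and its rate twin `rr`; the keyed reading of `Spine ₁₁C` itself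
# (cell `pub-ymgap`, HUMAN RULING D-0062 Track A, R134 seat `pub-ymgap-dag-n27-c` (s2); `--supports stmt-QuantumFields-19676` = K3 `SpineGivenEndpointR11`; count-neutral)

WHY.  At Stage 11 every record pair `(D, w)` comes with a parameter tuple realising the datum, `D = Node00.datumOfRecord₁₁ F N θ hP` (`IsRecordOfRecord₁₁C`), and binder B5
does not read the world (XX §2).  So «B5 at every ₁₁C record» IS «B5 at `datumOfRecord₁₁ F N θ hP` for every admissible `θ` with provisos» (§1) — a statement about NODE 00's
objects, no world, no record predicate.  The children's seats key their ₁₁ products the same way: n20-e reads `S_N20 SRec` at a predicate KEYED by a reading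
`cr : (F) → (θ : Stage11Params F N) → θ.Provisos₁₁ → (ℕ → ℝ) → List (ULoop F) → SpineCarriers` as «for every admissible `θ` with provisos, every `g₀`, `os`: NE7b's
`RelWeightBound` at `cr F θ hP g₀ os`» (`N20AtRecord11.s_N20_keyed₁₁_iff`).  THIS FILE states N27's whole input list in that currency — N20, N21, the six rates (K4) at a rate
reading `rr` off the SAME tuple, the N19′ ∃δ-edge coupling `cr θ` with `rr θ` (same key — the honest coupling the parametric pair `SRec`∕`RRec` cannot express), and the keyed
extraction clause (E1∕E2 + positivity under the prefix at the datum of record) — and concludes `Spine ₁₁C` by XII `spine_of_coreEdge` at the inline keyed spine-carrier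
predicate `fun F D g₀ os S => ∃ θ hP, θ.Admissible ∧ D = datumOfRecord₁₁ F N θ hP ∧ S = cr F θ hP g₀ os ∧ RatesAt D (rr F θ hP g₀ os)` with `Inputs := ⊤` (K4 absorbed into
the key; its hook discharged by `ForSmallCouplings.of_forall`).  `cr`, `rr` are PARAMETERS: no reading of Bałaban's history expansion ∕ rate carriers off the record exists
in the tree (R141 (A) `node00-def-RR` definers); instantiation = substitution.

WHAT IS KERNEL-CHECKED ([bookkeeping]; 0 `def`, 0 `sorry`).
* §1 **`spine_rec11C_iff_forall_datumOfRecord₁₁`** — `Spine ₁₁C ↔ ∀ F θ hP, θ.Admissible → HybridNE7Under (datumOfRecord₁₁ F N θ hP) END` (→ XX `b5_datumOfRecord₁₁`-style via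
  Record11's `exists_world_isRecordOfRecord₁₁C`; ← the record's own witness).
* §2 **`spine_rec11C_of_keyed₁₁`** (hypotheses `h20 h21 hrates h19 hx` keyed at `(θ, hP)`, conclusion `Spine ₁₁C`) · `ratesAt_keyed₁₁_of_six` (the joint `RatesAt` at the rate
  reading from the six keyed rate stubs N14 · N15 · N16 · N17 · N18 · N22) · `spine_rec11C_of_keyed₁₁_six` · `b5_datumOfRecord₁₁_of_keyed₁₁` (datum-level corollary, §1 ∘ §2).
* §3 the SRec-level bridges, so the children's keyed products feed §2 BY NAME: `s_N20_keyedRates_of_keyed₁₁` ∕ `s_N21_keyedRates_of_keyed₁₁` (the object-level N20 ∕ N21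
  readings give the stubs at the inline keyed predicate) · `s_N27x_keyedRates_of_keyed₁₁` (the keyed extraction clause + keyed rates give `S_N27x ₁₁C` there) ·
  `coreEdge_keyedRates_of_keyed₁₁` (the keyed N19′ edge gives XII's ∃δ-edge there, `Inputs := ⊤`).
* §4 (v1.1) THE TWO-KEY JUNCTION (the rate-record home as DIVIDED by dag-lead WORDS-99: (T-SPINE) `SRec₁₁` keyed by `cr`, (T-RATE) `RRec₁₁` keyed by `rr`, SEPARATELY):
  `coreEdge_of_twoKeys₁₁` (XIV's N19′ edge at any `SRec`∕`RRec` CHARACTERISED by the two functional keys, from the keyed edge stated for every PAIR of tuples with the same datum —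
  `θ` is not determined by `D`) · **`spine_rec11C_of_rateStubs_twoKeys₁₁`** (XIV `spine_of_rateStubs_coreEdge` at such `SRec`∕`RRec`: the (T-SPINE)∕(T-RATE) one-application stub
  instances + the two-key N19′ edge ⇒ `Spine ₁₁C`) · `spine_rec11C_of_rateStubs_twoKeys₁₁_glueN17`.

HONEST FRAMING.  COMPOSITE-node bookkeeping: every keyed hypothesis is 0∕1 today (no `cr`∕`rr` of record; NE7 ∕ NE7b ∕ NE7c ∕ NE1′–NE9 hypothesis shapes, none printed for the
d = 4 procedure, none proved); the prefix-free keyed readings ask the estimates at EVERY bare sequence `g₀` — off the tuned small-coupling runs the reading may be junk (the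
definer's freedom, as in n20-e's design; E1∕E2 pin the carriers to the true partition functions only under the prefix); inhabitation of ₁₁C at `N ≥ 2` is K0 (open); nothing of
Bałaban's instantiated or asserted; NO node discharged; typed 28∕28, count untouched; one finite four-torus programme at fixed ε — NOT ℝ⁴, NOT infinite volume, NOT OS, NOT a
mass gap, NOT Clay.  Restate-immune (route file not imported; the `N = 2` item faces are module XXI's).  No decl below carries a cite tag.
-/

namespace Summit.QuantumFields.YangMills.Theorems.BalabanUVNodesN27SpineRecord

open Literature.MathematicalPhysics.QuantumFieldTheory.Balaban1983to89
open Literature.MathematicalPhysics.QuantumFieldTheory.Balaban1983to89.T4Continuum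
open T4WeightBudget (RelWeightBound)
open T4IndicatorShell (ShellWeightBound)
open T4ContinuumYM4Torus (ForSmallCouplings)
open Summit.QuantumFields.BalabanUV.T4Continuum.Spine
open YMDAG.UVSplit
open Node00 (Stage11Params datumOfRecord₁₁ IsRecordOfRecord₁₁C)

variable {N : ℕ} [NeZero N]

/-! ## §1 The keyed reading of `Spine ₁₁C`: B5 at every Stage-11 DATUM OF RECORD -/

/-- **`Spine ₁₁C` IS «B5 AT `datumOfRecord₁₁ F N θ hP` FOR EVERY ADMISSIBLE `θ` WITH PROVISOS»** — the world is eliminated: (→) every such datum is a ₁₁C record at some world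
(Record11 `exists_world_isRecordOfRecord₁₁C`, window `θ.γ`, `0 < θ.γ` from admissibility) and B5 does not read the world; (←) a ₁₁C record pair carries its own realising tuple.
At `N = 2` the left side is the item K3 (module XXI). [bookkeeping] -/
theorem spine_rec11C_iff_forall_datumOfRecord₁₁ :
    (Spine (N := N) fun F D w => IsRecordOfRecord₁₁C F N D w) ↔
      ∀ (F : T4Family) (θ : Stage11Params F N) (hP : θ.Provisos₁₁), θ.Admissible →
        T4ApexHybrid.HybridNE7Under (datumOfRecord₁₁ F N θ hP) (DagBinding.EndpointExistence (datumOfRecord₁₁ F N θ hP).C.toB12) := by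
  refine ⟨fun h F θ hP hθ => ?_, fun h F D w hR => ?_⟩
  · obtain ⟨w, hw, -⟩ := Node00.exists_world_isRecordOfRecord₁₁C F N θ hP hθ (γw := θ.γ) ⟨hθ.1.1.1.1.2, le_rfl⟩
    exact h F _ w hw
  · obtain ⟨θ, hP, hθ, rfl, -⟩ := hR
    exact h F θ hP hθ

/-! ## §2 B5 at ₁₁C from the children's estimates KEYED at the Stage-11 tuples (`cr`: spine carriers, `rr`: rate carriers, SAME key) -/

section Keyed

-- `cr`: n20-e's READING of spine carriers off NODE 00's Stage-11 parameter tuples with provisos (verbatim type); `rr`: its rate-carrier twin.  PARAMETERS of this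
-- module — no such readings of Bałaban's expansion exist in the tree.
variable (cr : (F : T4Family) → (θ : Stage11Params F N) → θ.Provisos₁₁ → (ℕ → ℝ) → List (ULoop F) → SpineCarriers)
  (rr : (F : T4Family) → (θ : Stage11Params F N) → θ.Provisos₁₁ → (ℕ → ℝ) → List (ULoop F) → RateCarriers N)

/-- **K4's CONCLUSION AT THE RATE READING FROM THE SIX KEYED RATE STUBS**: N14 NE1′ · N15 NE2 · N16 NE3 · N17 NE4 (on the datum of record) · N18 NE5 · N22 NE9 + fading memory at
`rr F θ hP g₀ os`, for every admissible `θ` with provisos, every `g₀`, `os` ⇒ `RatesAt (datumOfRecord₁₁ F N θ hP) (rr F θ hP g₀ os)` (the conjunction, module 2's `RatesAt`).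
[bookkeeping] -/
theorem ratesAt_keyed₁₁_of_six
    (h14 : ∀ (F : T4Family) (θ : Stage11Params F N) (hP : θ.Provisos₁₁), θ.Admissible → ∀ (g₀ : ℕ → ℝ) (os : List (ULoop F)), N14At (rr F θ hP g₀ os).ne1)
    (h15 : ∀ (F : T4Family) (θ : Stage11Params F N) (hP : θ.Provisos₁₁), θ.Admissible → ∀ (g₀ : ℕ → ℝ) (os : List (ULoop F)), N15At (rr F θ hP g₀ os).ne2)
    (h16 : ∀ (F : T4Family) (θ : Stage11Params F N) (hP : θ.Provisos₁₁), θ.Admissible → ∀ (g₀ : ℕ → ℝ) (os : List (ULoop F)), N16At (rr F θ hP g₀ os).ne3)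
    (h17 : ∀ (F : T4Family) (θ : Stage11Params F N) (hP : θ.Provisos₁₁), θ.Admissible → ∀ (g₀ : ℕ → ℝ) (os : List (ULoop F)),
      N17At (datumOfRecord₁₁ F N θ hP) (rr F θ hP g₀ os).u3)
    (h18 : ∀ (F : T4Family) (θ : Stage11Params F N) (hP : θ.Provisos₁₁), θ.Admissible → ∀ (g₀ : ℕ → ℝ) (os : List (ULoop F)), N18At (rr F θ hP g₀ os).u3)
    (h22 : ∀ (F : T4Family) (θ : Stage11Params F N) (hP : θ.Provisos₁₁), θ.Admissible → ∀ (g₀ : ℕ → ℝ) (os : List (ULoop F)), N22At (rr F θ hP g₀ os).u3)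
    (F : T4Family) (θ : Stage11Params F N) (hP : θ.Provisos₁₁) (hθ : θ.Admissible) (g₀ : ℕ → ℝ) (os : List (ULoop F)) :
    RatesAt (datumOfRecord₁₁ F N θ hP) (rr F θ hP g₀ os) :=
  ⟨h14 F θ hP hθ g₀ os, h15 F θ hP hθ g₀ os, h16 F θ hP hθ g₀ os, h17 F θ hP hθ g₀ os, h18 F θ hP hθ g₀ os, h22 F θ hP hθ g₀ os⟩

/-! ### §3 (placed first: used by §2's join) The stubs of XII at the inline keyed spine-carrier predicate
`fun F D g₀ os S => ∃ θ hP, θ.Admissible ∧ D = datumOfRecord₁₁ F N θ hP ∧ S = cr F θ hP g₀ os ∧ RatesAt D (rr F θ hP g₀ os)` -/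

/-- **`S_N20` AT THE KEYED PREDICATE from the object-level N20 reading** — the RHS of n20-e's `N20AtRecord11.s_N20_keyed₁₁_iff` (NE7b's `RelWeightBound` at `cr F θ hP g₀ os` for
every admissible `θ` with provisos, every `g₀`, `os`); the extra `RatesAt` conjunct of the key is not read. [bookkeeping] -/
theorem s_N20_keyedRates_of_keyed₁₁
    (h20 : ∀ (F : T4Family) (θ : Stage11Params F N) (hP : θ.Provisos₁₁), θ.Admissible → ∀ (g₀ : ℕ → ℝ) (os : List (ULoop F)),
      RelWeightBound (cr F θ hP g₀ os).l₀ (cr F θ hP g₀ os).T (cr F θ hP g₀ os).A (cr F θ hP g₀ os).B (cr F θ hP g₀ os).Bad (cr F θ hP g₀ os).W) :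
    S_N20 (N := N) fun F D g₀ os S => ∃ (θ : Stage11Params F N) (hP : θ.Provisos₁₁), θ.Admissible ∧ D = datumOfRecord₁₁ F N θ hP ∧
      S = cr F θ hP g₀ os ∧ RatesAt D (rr F θ hP g₀ os) := by
  intro F D g₀ os S hS
  obtain ⟨θ, hP, hθ, -, rfl, -⟩ := hS
  exact h20 F θ hP hθ g₀ os

/-- **`S_N21` AT THE KEYED PREDICATE from the object-level N21 reading** (NE7c's `ShellWeightBound` at `cr F θ hP g₀ os` for every admissible `θ` with provisos, every `g₀`, `os`).
[bookkeeping] -/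
theorem s_N21_keyedRates_of_keyed₁₁
    (h21 : ∀ (F : T4Family) (θ : Stage11Params F N) (hP : θ.Provisos₁₁), θ.Admissible → ∀ (g₀ : ℕ → ℝ) (os : List (ULoop F)),
      ShellWeightBound (cr F θ hP g₀ os).l₀ (cr F θ hP g₀ os).T (cr F θ hP g₀ os).A (cr F θ hP g₀ os).B (cr F θ hP g₀ os).shA (cr F θ hP g₀ os).shB
        (cr F θ hP g₀ os).Wsh) :
    S_N21 (N := N) fun F D g₀ os S => ∃ (θ : Stage11Params F N) (hP : θ.Provisos₁₁), θ.Admissible ∧ D = datumOfRecord₁₁ F N θ hP ∧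
      S = cr F θ hP g₀ os ∧ RatesAt D (rr F θ hP g₀ os) := by
  intro F D g₀ os S hS
  obtain ⟨θ, hP, hθ, -, rfl, -⟩ := hS
  exact h21 F θ hP hθ g₀ os

/-- **XII's ∃δ-EDGE AT THE KEYED PREDICATE (`Inputs := ⊤`) from the keyed N19′ edge** «for every admissible `θ` with provisos, every `g₀`, `os`: the six rates at `rr F θ hP g₀ os`
give SOME summable `δ` carrying `Spine.NE7.Core` on the shell-free cores of `cr F θ hP g₀ os`» — spine AND rate carriers off the SAME tuple; the key's `RatesAt` conjunct feeds it.
[bookkeeping] -/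
theorem coreEdge_keyedRates_of_keyed₁₁
    (h19 : ∀ (F : T4Family) (θ : Stage11Params F N) (hP : θ.Provisos₁₁), θ.Admissible → ∀ (g₀ : ℕ → ℝ) (os : List (ULoop F)),
      RatesAt (datumOfRecord₁₁ F N θ hP) (rr F θ hP g₀ os) → letI := (cr F θ hP g₀ os).dec
        ∃ δ : ℕ → ℝ, NE7.Core (cr F θ hP g₀ os).l₀ (cr F θ hP g₀ os).vol (cr F θ hP g₀ os).T (cr F θ hP g₀ os).Bad
          (fun K t τ => (cr F θ hP g₀ os).A K t τ - (cr F θ hP g₀ os).shA K t τ) (fun K t τ => (cr F θ hP g₀ os).B K t τ - (cr F θ hP g₀ os).shB K t τ) δ ∧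
          Summable δ)
    (F : T4Family) (D : Datum F N) (g₀ : ℕ → ℝ) (os : List (ULoop F)) (S : SpineCarriers)
    (hS : ∃ (θ : Stage11Params F N) (hP : θ.Provisos₁₁), θ.Admissible ∧ D = datumOfRecord₁₁ F N θ hP ∧ S = cr F θ hP g₀ os ∧ RatesAt D (rr F θ hP g₀ os))
    (_hI : True) : letI := S.dec
      ∃ δ : ℕ → ℝ, NE7.Core S.l₀ S.vol S.T S.Bad (fun K t τ => S.A K t τ - S.shA K t τ) (fun K t τ => S.B K t τ - S.shB K t τ) δ ∧ Summable δ := by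
  obtain ⟨θ, hP, hθ, rfl, rfl, hr⟩ := hS
  exact h19 F θ hP hθ g₀ os hr

/-- **`S_N27x ₁₁C` AT THE KEYED PREDICATE from the keyed extraction clause and the keyed rates**: at a ₁₁C record the datum IS `datumOfRecord₁₁ F N θ hP` for the record's own tuple;
the keyed extraction clause gives, under (B) and END, for all small tuned `g₀` and every `os`, positivity and E1∕E2 at `cr F θ hP g₀ os`; the keyed rates (`hrates`) supply the
key's `RatesAt` conjunct at the SAME tuple — so the bundle `cr F θ hP g₀ os` is pinned by the keyed predicate. [bookkeeping] -/
theorem s_N27x_keyedRates_of_keyed₁₁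
    (hrates : ∀ (F : T4Family) (θ : Stage11Params F N) (hP : θ.Provisos₁₁), θ.Admissible → ∀ (g₀ : ℕ → ℝ) (os : List (ULoop F)),
      RatesAt (datumOfRecord₁₁ F N θ hP) (rr F θ hP g₀ os))
    (hx : ∀ (F : T4Family) (θ : Stage11Params F N) (hP : θ.Provisos₁₁), θ.Admissible →
      B16.EndStatementBPrinted (datumOfRecord₁₁ F N θ hP).C → DagBinding.EndpointExistence (datumOfRecord₁₁ F N θ hP).C.toB12 →
        ForSmallCouplings (datumOfRecord₁₁ F N θ hP) fun g₀ => ∀ os : List (ULoop F),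
          0 < (cr F θ hP g₀ os).l₀ ∧ 0 < (cr F θ hP g₀ os).vol ∧
          (∀ (K : ℕ) (t : ℝ), |t| ≤ (cr F θ hP g₀ os).l₀ →
            T4GenFunBounds.schemeZ ((datumOfRecord₁₁ F N θ hP).scheme g₀) os ((cr F θ hP g₀ os).K₀ + K) t =
              ∑ τ ∈ (cr F θ hP g₀ os).T K, (cr F θ hP g₀ os).A K t τ) ∧
          (∀ (K : ℕ) (t : ℝ), |t| ≤ (cr F θ hP g₀ os).l₀ →
            T4GenFunBounds.schemeZ ((datumOfRecord₁₁ F N θ hP).scheme g₀) os ((cr F θ hP g₀ os).K₀ + K + 1) t =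
              ∑ τ ∈ (cr F θ hP g₀ os).T K, (cr F θ hP g₀ os).B K t τ)) :
    S_N27x (N := N) (fun F D w => IsRecordOfRecord₁₁C F N D w) fun F D g₀ os S => ∃ (θ : Stage11Params F N) (hP : θ.Provisos₁₁), θ.Admissible ∧
      D = datumOfRecord₁₁ F N θ hP ∧ S = cr F θ hP g₀ os ∧ RatesAt D (rr F θ hP g₀ os) := by
  intro F D w hR hB hEnd
  obtain ⟨θ, hP, hθ, rfl, -⟩ := hR
  refine (hx F θ hP hθ hB hEnd).mono fun g₀ hg os => ?_
  obtain ⟨hl₀, hvol, hZA, hZB⟩ := hg os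
  exact ⟨cr F θ hP g₀ os, ⟨θ, hP, hθ, rfl, rfl, hrates F θ hP hθ g₀ os⟩, hl₀, hvol, hZA, hZB⟩

/-! ### §2 (the join) -/

/-- **N27 = B5 AT THE STAGE-11 RECORD FROM THE CHILDREN'S ESTIMATES KEYED AT NODE 00's TUPLES.**  For readings `cr` (spine carriers) and `rr` (rate carriers) off the Stage-11
parameter tuples: if for EVERY admissible `θ` with provisos, every bare sequence `g₀` and every loop string `os` — N20 NE7b `RelWeightBound` at `cr F θ hP g₀ os` (`h20`, the RHS of
n20-e's `s_N20_keyed₁₁_iff`) · N21 NE7c `ShellWeightBound` there (`h21`) · K4: the six rates at `rr F θ hP g₀ os` on the datum of record (`hrates`, e.g. `ratesAt_keyed₁₁_of_six`) · N19′: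
those rates give SOME summable `δ` carrying `Spine.NE7.Core` on the shell-free cores of `cr F θ hP g₀ os` (`h19`) — and, under (B) and END at the datum of record, for all small tuned
`g₀` and every `os`, `0 < l₀`, `0 < vol` and the E1∕E2 dictionary hold at `cr F θ hP g₀ os` (`hx`, N27x keyed), THEN `Spine ₁₁C`: binder B5 at every Stage-11 record pair.  Proof:
XII `spine_of_coreEdge` at the inline keyed spine-carrier predicate (§3's four stubs), `Inputs := ⊤`, K4's hook by `ForSmallCouplings.of_forall`.  Every hypothesis 0∕1 today.
[bookkeeping] -/
theorem spine_rec11C_of_keyed₁₁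
    (h20 : ∀ (F : T4Family) (θ : Stage11Params F N) (hP : θ.Provisos₁₁), θ.Admissible → ∀ (g₀ : ℕ → ℝ) (os : List (ULoop F)),
      RelWeightBound (cr F θ hP g₀ os).l₀ (cr F θ hP g₀ os).T (cr F θ hP g₀ os).A (cr F θ hP g₀ os).B (cr F θ hP g₀ os).Bad (cr F θ hP g₀ os).W)
    (h21 : ∀ (F : T4Family) (θ : Stage11Params F N) (hP : θ.Provisos₁₁), θ.Admissible → ∀ (g₀ : ℕ → ℝ) (os : List (ULoop F)),
      ShellWeightBound (cr F θ hP g₀ os).l₀ (cr F θ hP g₀ os).T (cr F θ hP g₀ os).A (cr F θ hP g₀ os).B (cr F θ hP g₀ os).shA (cr F θ hP g₀ os).shB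
        (cr F θ hP g₀ os).Wsh)
    (hrates : ∀ (F : T4Family) (θ : Stage11Params F N) (hP : θ.Provisos₁₁), θ.Admissible → ∀ (g₀ : ℕ → ℝ) (os : List (ULoop F)),
      RatesAt (datumOfRecord₁₁ F N θ hP) (rr F θ hP g₀ os))
    (h19 : ∀ (F : T4Family) (θ : Stage11Params F N) (hP : θ.Provisos₁₁), θ.Admissible → ∀ (g₀ : ℕ → ℝ) (os : List (ULoop F)),
      RatesAt (datumOfRecord₁₁ F N θ hP) (rr F θ hP g₀ os) → letI := (cr F θ hP g₀ os).dec
        ∃ δ : ℕ → ℝ, NE7.Core (cr F θ hP g₀ os).l₀ (cr F θ hP g₀ os).vol (cr F θ hP g₀ os).T (cr F θ hP g₀ os).Bad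
          (fun K t τ => (cr F θ hP g₀ os).A K t τ - (cr F θ hP g₀ os).shA K t τ) (fun K t τ => (cr F θ hP g₀ os).B K t τ - (cr F θ hP g₀ os).shB K t τ) δ ∧
          Summable δ)
    (hx : ∀ (F : T4Family) (θ : Stage11Params F N) (hP : θ.Provisos₁₁), θ.Admissible →
      B16.EndStatementBPrinted (datumOfRecord₁₁ F N θ hP).C → DagBinding.EndpointExistence (datumOfRecord₁₁ F N θ hP).C.toB12 →
        ForSmallCouplings (datumOfRecord₁₁ F N θ hP) fun g₀ => ∀ os : List (ULoop F),
          0 < (cr F θ hP g₀ os).l₀ ∧ 0 < (cr F θ hP g₀ os).vol ∧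
          (∀ (K : ℕ) (t : ℝ), |t| ≤ (cr F θ hP g₀ os).l₀ →
            T4GenFunBounds.schemeZ ((datumOfRecord₁₁ F N θ hP).scheme g₀) os ((cr F θ hP g₀ os).K₀ + K) t =
              ∑ τ ∈ (cr F θ hP g₀ os).T K, (cr F θ hP g₀ os).A K t τ) ∧
          (∀ (K : ℕ) (t : ℝ), |t| ≤ (cr F θ hP g₀ os).l₀ →
            T4GenFunBounds.schemeZ ((datumOfRecord₁₁ F N θ hP).scheme g₀) os ((cr F θ hP g₀ os).K₀ + K + 1) t =
              ∑ τ ∈ (cr F θ hP g₀ os).T K, (cr F θ hP g₀ os).B K t τ)) :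
    Spine (N := N) fun F D w => IsRecordOfRecord₁₁C F N D w :=
  spine_of_coreEdge (fun F D w => IsRecordOfRecord₁₁C F N D w)
    (fun F D g₀ os S => ∃ (θ : Stage11Params F N) (hP : θ.Provisos₁₁), θ.Admissible ∧ D = datumOfRecord₁₁ F N θ hP ∧
      S = cr F θ hP g₀ os ∧ RatesAt D (rr F θ hP g₀ os))
    (fun _ _ _ _ => True)
    (s_N27x_keyedRates_of_keyed₁₁ cr rr hrates hx) (s_N20_keyedRates_of_keyed₁₁ cr rr h20) (s_N21_keyedRates_of_keyed₁₁ cr rr h21)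
    (coreEdge_keyedRates_of_keyed₁₁ cr rr h19) fun _ _ _ _ _ _ => ForSmallCouplings.of_forall fun _ _ => trivial

/-- **The same with the SIX KEYED RATE STUBS** N14 · N15 · N16 · N17 · N18 · N22 at `rr F θ hP g₀ os` in place of the joint `RatesAt` (`ratesAt_keyed₁₁_of_six`). [bookkeeping] -/
theorem spine_rec11C_of_keyed₁₁_six
    (h20 : ∀ (F : T4Family) (θ : Stage11Params F N) (hP : θ.Provisos₁₁), θ.Admissible → ∀ (g₀ : ℕ → ℝ) (os : List (ULoop F)),
      RelWeightBound (cr F θ hP g₀ os).l₀ (cr F θ hP g₀ os).T (cr F θ hP g₀ os).A (cr F θ hP g₀ os).B (cr F θ hP g₀ os).Bad (cr F θ hP g₀ os).W)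
    (h21 : ∀ (F : T4Family) (θ : Stage11Params F N) (hP : θ.Provisos₁₁), θ.Admissible → ∀ (g₀ : ℕ → ℝ) (os : List (ULoop F)),
      ShellWeightBound (cr F θ hP g₀ os).l₀ (cr F θ hP g₀ os).T (cr F θ hP g₀ os).A (cr F θ hP g₀ os).B (cr F θ hP g₀ os).shA (cr F θ hP g₀ os).shB
        (cr F θ hP g₀ os).Wsh)
    (h14 : ∀ (F : T4Family) (θ : Stage11Params F N) (hP : θ.Provisos₁₁), θ.Admissible → ∀ (g₀ : ℕ → ℝ) (os : List (ULoop F)), N14At (rr F θ hP g₀ os).ne1)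
    (h15 : ∀ (F : T4Family) (θ : Stage11Params F N) (hP : θ.Provisos₁₁), θ.Admissible → ∀ (g₀ : ℕ → ℝ) (os : List (ULoop F)), N15At (rr F θ hP g₀ os).ne2)
    (h16 : ∀ (F : T4Family) (θ : Stage11Params F N) (hP : θ.Provisos₁₁), θ.Admissible → ∀ (g₀ : ℕ → ℝ) (os : List (ULoop F)), N16At (rr F θ hP g₀ os).ne3)
    (h17 : ∀ (F : T4Family) (θ : Stage11Params F N) (hP : θ.Provisos₁₁), θ.Admissible → ∀ (g₀ : ℕ → ℝ) (os : List (ULoop F)),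
      N17At (datumOfRecord₁₁ F N θ hP) (rr F θ hP g₀ os).u3)
    (h18 : ∀ (F : T4Family) (θ : Stage11Params F N) (hP : θ.Provisos₁₁), θ.Admissible → ∀ (g₀ : ℕ → ℝ) (os : List (ULoop F)), N18At (rr F θ hP g₀ os).u3)
    (h22 : ∀ (F : T4Family) (θ : Stage11Params F N) (hP : θ.Provisos₁₁), θ.Admissible → ∀ (g₀ : ℕ → ℝ) (os : List (ULoop F)), N22At (rr F θ hP g₀ os).u3)
    (h19 : ∀ (F : T4Family) (θ : Stage11Params F N) (hP : θ.Provisos₁₁), θ.Admissible → ∀ (g₀ : ℕ → ℝ) (os : List (ULoop F)),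
      RatesAt (datumOfRecord₁₁ F N θ hP) (rr F θ hP g₀ os) → letI := (cr F θ hP g₀ os).dec
        ∃ δ : ℕ → ℝ, NE7.Core (cr F θ hP g₀ os).l₀ (cr F θ hP g₀ os).vol (cr F θ hP g₀ os).T (cr F θ hP g₀ os).Bad
          (fun K t τ => (cr F θ hP g₀ os).A K t τ - (cr F θ hP g₀ os).shA K t τ) (fun K t τ => (cr F θ hP g₀ os).B K t τ - (cr F θ hP g₀ os).shB K t τ) δ ∧
          Summable δ)
    (hx : ∀ (F : T4Family) (θ : Stage11Params F N) (hP : θ.Provisos₁₁), θ.Admissible →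
      B16.EndStatementBPrinted (datumOfRecord₁₁ F N θ hP).C → DagBinding.EndpointExistence (datumOfRecord₁₁ F N θ hP).C.toB12 →
        ForSmallCouplings (datumOfRecord₁₁ F N θ hP) fun g₀ => ∀ os : List (ULoop F),
          0 < (cr F θ hP g₀ os).l₀ ∧ 0 < (cr F θ hP g₀ os).vol ∧
          (∀ (K : ℕ) (t : ℝ), |t| ≤ (cr F θ hP g₀ os).l₀ →
            T4GenFunBounds.schemeZ ((datumOfRecord₁₁ F N θ hP).scheme g₀) os ((cr F θ hP g₀ os).K₀ + K) t =
              ∑ τ ∈ (cr F θ hP g₀ os).T K, (cr F θ hP g₀ os).A K t τ) ∧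
          (∀ (K : ℕ) (t : ℝ), |t| ≤ (cr F θ hP g₀ os).l₀ →
            T4GenFunBounds.schemeZ ((datumOfRecord₁₁ F N θ hP).scheme g₀) os ((cr F θ hP g₀ os).K₀ + K + 1) t =
              ∑ τ ∈ (cr F θ hP g₀ os).T K, (cr F θ hP g₀ os).B K t τ)) :
    Spine (N := N) fun F D w => IsRecordOfRecord₁₁C F N D w :=
  spine_rec11C_of_keyed₁₁ cr rr h20 h21 (ratesAt_keyed₁₁_of_six rr h14 h15 h16 h17 h18 h22) h19 hx

/-- **DATUM-LEVEL COROLLARY**: under the keyed hypotheses of `spine_rec11C_of_keyed₁₁`, binder B5 holds at `datumOfRecord₁₁ F N θ hP` for EVERY admissible `θ` with provisos (§1 ∘ §2).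
[bookkeeping] -/
theorem b5_datumOfRecord₁₁_of_keyed₁₁
    (h20 : ∀ (F : T4Family) (θ : Stage11Params F N) (hP : θ.Provisos₁₁), θ.Admissible → ∀ (g₀ : ℕ → ℝ) (os : List (ULoop F)),
      RelWeightBound (cr F θ hP g₀ os).l₀ (cr F θ hP g₀ os).T (cr F θ hP g₀ os).A (cr F θ hP g₀ os).B (cr F θ hP g₀ os).Bad (cr F θ hP g₀ os).W)
    (h21 : ∀ (F : T4Family) (θ : Stage11Params F N) (hP : θ.Provisos₁₁), θ.Admissible → ∀ (g₀ : ℕ → ℝ) (os : List (ULoop F)),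
      ShellWeightBound (cr F θ hP g₀ os).l₀ (cr F θ hP g₀ os).T (cr F θ hP g₀ os).A (cr F θ hP g₀ os).B (cr F θ hP g₀ os).shA (cr F θ hP g₀ os).shB
        (cr F θ hP g₀ os).Wsh)
    (hrates : ∀ (F : T4Family) (θ : Stage11Params F N) (hP : θ.Provisos₁₁), θ.Admissible → ∀ (g₀ : ℕ → ℝ) (os : List (ULoop F)),
      RatesAt (datumOfRecord₁₁ F N θ hP) (rr F θ hP g₀ os))
    (h19 : ∀ (F : T4Family) (θ : Stage11Params F N) (hP : θ.Provisos₁₁), θ.Admissible → ∀ (g₀ : ℕ → ℝ) (os : List (ULoop F)),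
      RatesAt (datumOfRecord₁₁ F N θ hP) (rr F θ hP g₀ os) → letI := (cr F θ hP g₀ os).dec
        ∃ δ : ℕ → ℝ, NE7.Core (cr F θ hP g₀ os).l₀ (cr F θ hP g₀ os).vol (cr F θ hP g₀ os).T (cr F θ hP g₀ os).Bad
          (fun K t τ => (cr F θ hP g₀ os).A K t τ - (cr F θ hP g₀ os).shA K t τ) (fun K t τ => (cr F θ hP g₀ os).B K t τ - (cr F θ hP g₀ os).shB K t τ) δ ∧
          Summable δ)
    (hx : ∀ (F : T4Family) (θ : Stage11Params F N) (hP : θ.Provisos₁₁), θ.Admissible →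
      B16.EndStatementBPrinted (datumOfRecord₁₁ F N θ hP).C → DagBinding.EndpointExistence (datumOfRecord₁₁ F N θ hP).C.toB12 →
        ForSmallCouplings (datumOfRecord₁₁ F N θ hP) fun g₀ => ∀ os : List (ULoop F),
          0 < (cr F θ hP g₀ os).l₀ ∧ 0 < (cr F θ hP g₀ os).vol ∧
          (∀ (K : ℕ) (t : ℝ), |t| ≤ (cr F θ hP g₀ os).l₀ →
            T4GenFunBounds.schemeZ ((datumOfRecord₁₁ F N θ hP).scheme g₀) os ((cr F θ hP g₀ os).K₀ + K) t =
              ∑ τ ∈ (cr F θ hP g₀ os).T K, (cr F θ hP g₀ os).A K t τ) ∧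
          (∀ (K : ℕ) (t : ℝ), |t| ≤ (cr F θ hP g₀ os).l₀ →
            T4GenFunBounds.schemeZ ((datumOfRecord₁₁ F N θ hP).scheme g₀) os ((cr F θ hP g₀ os).K₀ + K + 1) t =
              ∑ τ ∈ (cr F θ hP g₀ os).T K, (cr F θ hP g₀ os).B K t τ))
    (F : T4Family) (θ : Stage11Params F N) (hP : θ.Provisos₁₁) (hθ : θ.Admissible) :
    T4ApexHybrid.HybridNE7Under (datumOfRecord₁₁ F N θ hP) (DagBinding.EndpointExistence (datumOfRecord₁₁ F N θ hP).C.toB12) :=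
  spine_rec11C_iff_forall_datumOfRecord₁₁.mp (spine_rec11C_of_keyed₁₁ cr rr h20 h21 hrates h19 hx) F θ hP hθ

end Keyed

/-! ## §4 (v1.1, append-only) THE TWO-KEY JUNCTION: spine carriers keyed by `cr`, rate carriers keyed by `rr`, as SEPARATE record predicates (dag-lead WORDS-99's division of the
rate-record home: (T-SPINE) `SRec₁₁`, (T-RATE) `RRec₁₁`) — the N19′ edge must then serve every PAIR of tuples realising the same datum -/

section TwoKeys

variable (SRec : SpineRecordPred N) (RRec : RateRecordPred N)
  (cr : (F : T4Family) → (θ : Stage11Params F N) → θ.Provisos₁₁ → (ℕ → ℝ) → List (ULoop F) → SpineCarriers)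
  (rr : (F : T4Family) → (θ : Stage11Params F N) → θ.Provisos₁₁ → (ℕ → ℝ) → List (ULoop F) → RateCarriers N)

/-- **XIV's N19′ EDGE AT TWO SEPARATELY KEYED CARRIER RECORDS.**  Let `SRec` be CHARACTERISED by the spine key (`hkeyS`: it pins at `(F, D, g₀, os)` exactly the bundles `cr F θ hP g₀ os`
of the admissible tuples with provisos realising `D` — (T-SPINE)'s `SRec₁₁ cr` satisfies it by `Iff.rfl`) and `RRec` by the rate key (`hkeyR`, (T-RATE)'s shape).  A bundle `S` and rate
carriers `R` pinned at the same `(F, D, g₀, os)` come from tuples `(θ, hP)`, `(θ', hP')` with `datumOfRecord₁₁ F N θ hP = D = datumOfRecord₁₁ F N θ' hP'` — NOT necessarily equal (the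
datum does not determine the tuple).  So the keyed N19′ edge that feeds XIV's join is the one stated for EVERY SUCH PAIR (`h19₂`): the six rates at `rr F θ' hP' g₀ os` on the common
datum give SOME summable `δ` carrying `Spine.NE7.Core` on the shell-free cores of `cr F θ hP g₀ os`. [bookkeeping] -/
theorem coreEdge_of_twoKeys₁₁
    (hkeyS : ∀ (F : T4Family) (D : Datum F N) (g₀ : ℕ → ℝ) (os : List (ULoop F)) (S : SpineCarriers), SRec F D g₀ os S ↔
      ∃ (θ : Stage11Params F N) (hP : θ.Provisos₁₁), θ.Admissible ∧ D = datumOfRecord₁₁ F N θ hP ∧ S = cr F θ hP g₀ os)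
    (hkeyR : ∀ (F : T4Family) (D : Datum F N) (g₀ : ℕ → ℝ) (os : List (ULoop F)) (R : RateCarriers N), RRec F D g₀ os R ↔
      ∃ (θ : Stage11Params F N) (hP : θ.Provisos₁₁), θ.Admissible ∧ D = datumOfRecord₁₁ F N θ hP ∧ R = rr F θ hP g₀ os)
    (h19₂ : ∀ (F : T4Family) (θ : Stage11Params F N) (hP : θ.Provisos₁₁) (θ' : Stage11Params F N) (hP' : θ'.Provisos₁₁), θ.Admissible → θ'.Admissible →
      datumOfRecord₁₁ F N θ' hP' = datumOfRecord₁₁ F N θ hP → ∀ (g₀ : ℕ → ℝ) (os : List (ULoop F)),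
        RatesAt (datumOfRecord₁₁ F N θ hP) (rr F θ' hP' g₀ os) → letI := (cr F θ hP g₀ os).dec
          ∃ δ : ℕ → ℝ, NE7.Core (cr F θ hP g₀ os).l₀ (cr F θ hP g₀ os).vol (cr F θ hP g₀ os).T (cr F θ hP g₀ os).Bad
            (fun K t τ => (cr F θ hP g₀ os).A K t τ - (cr F θ hP g₀ os).shA K t τ) (fun K t τ => (cr F θ hP g₀ os).B K t τ - (cr F θ hP g₀ os).shB K t τ) δ ∧
            Summable δ)
    (F : T4Family) (D : Datum F N) (g₀ : ℕ → ℝ) (os : List (ULoop F)) (S : SpineCarriers) (R : RateCarriers N)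
    (hS : SRec F D g₀ os S) (hR : RRec F D g₀ os R) (hrates : RatesAt D R) : letI := S.dec
      ∃ δ : ℕ → ℝ, NE7.Core S.l₀ S.vol S.T S.Bad (fun K t τ => S.A K t τ - S.shA K t τ) (fun K t τ => S.B K t τ - S.shB K t τ) δ ∧ Summable δ := by
  obtain ⟨θ, hP, hθ, rfl, rfl⟩ := (hkeyS F D g₀ os S).mp hS
  obtain ⟨θ', hP', hθ', hD, rfl⟩ := (hkeyR F _ g₀ os R).mp hR
  exact h19₂ F θ hP θ' hP' hθ hθ' hD.symm g₀ os hrates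

/-- **N27 = B5 AT THE STAGE-11 RECORD FROM THE STUB INSTANCES OF THE DIVIDED RATE-RECORD HOME AND THE TWO-KEY N19′ EDGE.**  For ANY spine-carrier record `SRec` characterised by the
key `cr` and ANY rate-carrier record `RRec` characterised by the key `rr` ((T-SPINE) ∕ (T-RATE) shapes, `hkeyS` ∕ `hkeyR`): the K4 stubs `S_R00x ₁₁C RRec` · `S_N14`–`S_N18`, `S_N22` at
`RRec`, the K5 stubs `S_N27x ₁₁C SRec` · `S_N20` · `S_N21` at `SRec` (= the home modules' one-application instances of the children's keyed estimates) and the two-key N19′ edge `h19₂`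
give `Spine ₁₁C` — XIV `spine_of_rateStubs_coreEdge` with `coreEdge_of_twoKeys₁₁`.  Every stub a HYPOTHESIS (0∕1 today). [bookkeeping] -/
theorem spine_rec11C_of_rateStubs_twoKeys₁₁
    (hkeyS : ∀ (F : T4Family) (D : Datum F N) (g₀ : ℕ → ℝ) (os : List (ULoop F)) (S : SpineCarriers), SRec F D g₀ os S ↔
      ∃ (θ : Stage11Params F N) (hP : θ.Provisos₁₁), θ.Admissible ∧ D = datumOfRecord₁₁ F N θ hP ∧ S = cr F θ hP g₀ os)
    (hkeyR : ∀ (F : T4Family) (D : Datum F N) (g₀ : ℕ → ℝ) (os : List (ULoop F)) (R : RateCarriers N), RRec F D g₀ os R ↔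
      ∃ (θ : Stage11Params F N) (hP : θ.Provisos₁₁), θ.Admissible ∧ D = datumOfRecord₁₁ F N θ hP ∧ R = rr F θ hP g₀ os)
    (hx : S_R00x (fun F D w => IsRecordOfRecord₁₁C F N D w) RRec) (h14 : S_N14 RRec) (h15 : S_N15 RRec) (h16 : S_N16 RRec) (h17 : S_N17 RRec)
    (h18 : S_N18 RRec) (h22 : S_N22 RRec) (hx' : S_N27x (fun F D w => IsRecordOfRecord₁₁C F N D w) SRec) (h20 : S_N20 SRec) (h21 : S_N21 SRec)
    (h19₂ : ∀ (F : T4Family) (θ : Stage11Params F N) (hP : θ.Provisos₁₁) (θ' : Stage11Params F N) (hP' : θ'.Provisos₁₁), θ.Admissible → θ'.Admissible →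
      datumOfRecord₁₁ F N θ' hP' = datumOfRecord₁₁ F N θ hP → ∀ (g₀ : ℕ → ℝ) (os : List (ULoop F)),
        RatesAt (datumOfRecord₁₁ F N θ hP) (rr F θ' hP' g₀ os) → letI := (cr F θ hP g₀ os).dec
          ∃ δ : ℕ → ℝ, NE7.Core (cr F θ hP g₀ os).l₀ (cr F θ hP g₀ os).vol (cr F θ hP g₀ os).T (cr F θ hP g₀ os).Bad
            (fun K t τ => (cr F θ hP g₀ os).A K t τ - (cr F θ hP g₀ os).shA K t τ) (fun K t τ => (cr F θ hP g₀ os).B K t τ - (cr F θ hP g₀ os).shB K t τ) δ ∧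
            Summable δ) :
    Spine (N := N) fun F D w => IsRecordOfRecord₁₁C F N D w :=
  spine_of_rateStubs_coreEdge _ SRec RRec hx h14 h15 h16 h17 h18 h22 hx' h20 h21 (coreEdge_of_twoKeys₁₁ SRec RRec cr rr hkeyS hkeyR h19₂)

/-- The same with N17 GLUED from (D4) · N18 · N22 at `RRec` (`N17_of_U3edge`; XIV `spine_of_rateStubs_coreEdge_glueN17`). [bookkeeping] -/
theorem spine_rec11C_of_rateStubs_twoKeys₁₁_glueN17
    (hkeyS : ∀ (F : T4Family) (D : Datum F N) (g₀ : ℕ → ℝ) (os : List (ULoop F)) (S : SpineCarriers), SRec F D g₀ os S ↔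
      ∃ (θ : Stage11Params F N) (hP : θ.Provisos₁₁), θ.Admissible ∧ D = datumOfRecord₁₁ F N θ hP ∧ S = cr F θ hP g₀ os)
    (hkeyR : ∀ (F : T4Family) (D : Datum F N) (g₀ : ℕ → ℝ) (os : List (ULoop F)) (R : RateCarriers N), RRec F D g₀ os R ↔
      ∃ (θ : Stage11Params F N) (hP : θ.Provisos₁₁), θ.Admissible ∧ D = datumOfRecord₁₁ F N θ hP ∧ R = rr F θ hP g₀ os)
    (hx : S_R00x (fun F D w => IsRecordOfRecord₁₁C F N D w) RRec) (h14 : S_N14 RRec) (h15 : S_N15 RRec) (h16 : S_N16 RRec)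
    (h18 : S_N18 RRec) (h22 : S_N22 RRec) (hD4 : S_D4 RRec) (hx' : S_N27x (fun F D w => IsRecordOfRecord₁₁C F N D w) SRec) (h20 : S_N20 SRec) (h21 : S_N21 SRec)
    (h19₂ : ∀ (F : T4Family) (θ : Stage11Params F N) (hP : θ.Provisos₁₁) (θ' : Stage11Params F N) (hP' : θ'.Provisos₁₁), θ.Admissible → θ'.Admissible →
      datumOfRecord₁₁ F N θ' hP' = datumOfRecord₁₁ F N θ hP → ∀ (g₀ : ℕ → ℝ) (os : List (ULoop F)),
        RatesAt (datumOfRecord₁₁ F N θ hP) (rr F θ' hP' g₀ os) → letI := (cr F θ hP g₀ os).dec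
          ∃ δ : ℕ → ℝ, NE7.Core (cr F θ hP g₀ os).l₀ (cr F θ hP g₀ os).vol (cr F θ hP g₀ os).T (cr F θ hP g₀ os).Bad
            (fun K t τ => (cr F θ hP g₀ os).A K t τ - (cr F θ hP g₀ os).shA K t τ) (fun K t τ => (cr F θ hP g₀ os).B K t τ - (cr F θ hP g₀ os).shB K t τ) δ ∧
            Summable δ) :
    Spine (N := N) fun F D w => IsRecordOfRecord₁₁C F N D w :=
  spine_of_rateStubs_coreEdge_glueN17 _ SRec RRec hx h14 h15 h16 h18 h22 hD4 hx' h20 h21 (coreEdge_of_twoKeys₁₁ SRec RRec cr rr hkeyS hkeyR h19₂)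

end TwoKeys

end Summit.QuantumFields.YangMills.Theorems.BalabanUVNodesN27SpineRecord
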